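import Summits.KontsevichZagierPeriods.KontsevichZagierPeriods.Theses.TerasomaMultiplication
import Summits.KontsevichZagierPeriods.KontsevichZagierPeriods.Theorems.TerasomaMultiplicationBetaCancellationOfAyoubPiCancellation
import Literature.NumberTheory.Transcendental.KZProductIdeal
import Summits.KontsevichZagierPeriods.KontsevichZagierPeriods.Theorems.CompleteModGammaSector.Negative.LoadBearing
import Summits.KontsevichZagierPeriods.KontsevichZagierPeriods.Theorems.FurushoPentagonReducedPeriodRingCubeMerge
import Literature.NumberTheory.Transcendental.KZCalculusProofs

/-!
# Leaf 2 `CubicalPiLocalKernelModGamma` — birth skeleton (cstrat-14233-r1)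

The irreducible transcendence core of the split (Ayoub's effective cube kernel, localised at the disc
class, modulo Γ). Its one honest seam is the MERGE: a value-zero element of the cubical span is ONE tame
cube class of value zero (landed `ReducedPeriodRing.stub_cubeMerge` + soundness), transported along the
pinned disc operator (stub 2, the pinned form of the left-ideal property `KZ.mul_mem_relations_left`,
PROVED below from the landed left-ideal property and the pinned/closed-term bridge). Stub 1 is the core
on ONE cube integral: an analytic `ℚ`-semialgebraic function on `[0,1]ⁿ` with vanishing integral becomes
Γ-accessible after finitely many disc factors. No dimension seam exists (tame slabs
`SectorToKernel.leaves_of_sub_of_prod_oneCube` make every "dimension ≥ d" restriction the whole stub) and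
no sub-presentation seam survives modulo Γ (census): this skeleton is deliberately ONE open stub (the core) + the proved transport.
[Ayoub 2014 Conj. 7, Rem. 12–13; Kontsevich–Zagier 2001 §4.1]
-/

noncomputable section
set_option linter.dupNamespace false

namespace Summit.KontsevichZagierPeriods.KontsevichZagierPeriods.Cruxes.CompleteModGammaSector.BirthCubicalPiLocalKernelModGamma

open MeasureTheory Set
open Literature.NumberTheory.Transcendental
open Literature.NumberTheory.Transcendental.KZ hiding cubicalSpan
open Summit.KontsevichZagierPeriods.FurushoPentagon.ReducedPeriodRing (unitCube cubicalGens cubicalSpan stub_cubeMerge)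

/-- Leaf 2 verbatim. -/
def CubicalPiLocalKernelModGamma : Prop :=
  ∀ (P : ∀ n : ℕ, Literature.NumberTheory.Transcendental.KZ.IntegralRep n → Literature.NumberTheory.Transcendental.KZ.IntegralRep (n + 2)), (∀ (n : ℕ) (r : Literature.NumberTheory.Transcendental.KZ.IntegralRep n), (P n r).domain = {z : Fin (n + 2) → ℝ | z 0 ^ 2 + z 1 ^ 2 ≤ 1 ∧ (fun i : Fin n => z i.succ.succ) ∈ r.domain} ∧ (P n r).integrand = fun z => r.integrand (fun i : Fin n => z i.succ.succ)) → ∀ a ∈ AddSubgroup.closure {d : Literature.NumberTheory.Transcendental.KZ.FormalRep | ∃ (n : ℕ) (ρ : Literature.NumberTheory.Transcendental.KZ.IntegralRep n), ρ.domain = {x | ∀ i, 0 ≤ x i ∧ x i ≤ 1} ∧ AnalyticOnNhd ℝ ρ.integrand {x | ∀ i, 0 ≤ x i ∧ x i ≤ 1} ∧ d = Literature.NumberTheory.Transcendental.KZ.of ρ}, Literature.NumberTheory.Transcendental.KZ.eval a = 0 → ∃ N : ℕ, (⇑(FreeAbelianGroup.lift (fun s : (Σ n, Literature.NumberTheory.Transcendental.KZ.IntegralRep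 n) => Literature.NumberTheory.Transcendental.KZ.of (P s.1 s.2))))^[N] a ∈ (Literature.NumberTheory.Transcendental.KZ.relations ⊔ AddSubgroup.closure {d : Literature.NumberTheory.Transcendental.KZ.FormalRep | ∃ (N N' k : ℕ) (x y : Fin N → ℚ) (x' y' : Fin N' → ℚ) (c : ℝ) (ρ : Literature.NumberTheory.Transcendental.KZ.IntegralRep N) (ρ' : Literature.NumberTheory.Transcendental.KZ.IntegralRep (2 * k + N')), (∀ j, 0 < x j ∧ 0 < y j ∧ Int.fract (x j) ≠ 0 ∧ Int.fract (y j) ≠ 0) ∧ (∀ l, 0 < x' l ∧ 0 < y' l ∧ Int.fract (x' l) ≠ 0 ∧ Int.fract (y' l) ≠ 0) ∧ (∀ u : ℕ, 0 < u → (∀ j, Nat.Coprime u (x j).den ∧ Nat.Coprime u (y j).den) → (∀ l, Nat.Coprime u (x' l).den ∧ Nat.Coprime u (y' l).den) → ((∑ j, (Int.fract ((u : ℚ) * x j) + Int.fract ((u : ℚ) * y j) - Int.fract ((u : ℚ) * (x j + y j)))) - ∑ l, (Int.fract ((u : ℚ) * x' l) + Int.fract ((u : ℚ) * y' l) - Int.fract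 ((u : ℚ) * (x' l + y' l)))) = (k : ℚ)) ∧ IsAlgebraic ℚ c ∧ ρ.domain = {t | ∀ j, t j ∈ Set.Ioo (0:ℝ) 1} ∧ Set.EqOn ρ.integrand (fun t => ∏ j, (t j) ^ ((x j : ℝ) - 1) * (1 - t j) ^ ((y j : ℝ) - 1)) ρ.domain ∧ ρ'.domain = {z | (∑ i : Fin (2 * k), (z (Fin.castAdd N' i)) ^ 2) < 1 ∧ ∀ l : Fin N', z (Fin.natAdd (2 * k) l) ∈ Set.Ioo (0:ℝ) 1} ∧ Set.EqOn ρ'.integrand (fun z => c * (k.factorial : ℝ) * ∏ l, (z (Fin.natAdd (2 * k) l)) ^ ((x' l : ℝ) - 1) * (1 - z (Fin.natAdd (2 * k) l)) ^ ((y' l : ℝ) - 1)) ρ'.domain ∧ ρ.value = ρ'.value ∧ d = Literature.NumberTheory.Transcendental.KZ.of ρ - Literature.NumberTheory.Transcendental.KZ.of ρ'})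

/-- **Stub 1 (the core on one tame cube).** For a pinned disc operator `P` and a tame cube
representation `t = [[0,1]ⁿ, g]` (`g` analytic near the closed cube) of value `0`, some iterate
`[disc]^N × t` is Γ-accessible. [cite: Ayoub2014, Conj. 7 and Rem. 13] [cite: KontsevichZagier2001, §4.1] -/
theorem stub_oneCubePiTorsionModGamma : ∀ (P : ∀ n : ℕ, Literature.NumberTheory.Transcendental.KZ.IntegralRep n → Literature.NumberTheory.Transcendental.KZ.IntegralRep (n + 2)), (∀ (n : ℕ) (r : Literature.NumberTheory.Transcendental.KZ.IntegralRep n), (P n r).domain = {z : Fin (n + 2) → ℝ | z 0 ^ 2 + z 1 ^ 2 ≤ 1 ∧ (fun i : Fin n => z i.succ.succ) ∈ r.domain} ∧ (P n r).integrand = fun z => r.integrand (fun i : Fin n => z i.succ.succ)) → ∀ (n : ℕ) (t : Literature.NumberTheory.Transcendental.KZ.IntegralRep n), t.domain = {x | ∀ i, 0 ≤ x i ∧ x i ≤ 1} → AnalyticOnNhd ℝ t.integrand {x | ∀ i, 0 ≤ x i ∧ x i ≤ 1} → t.value = 0 → ∃ N : ℕ, (⇑(FreeAbelianGroup.lift (fun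 s : (Σ n, Literature.NumberTheory.Transcendental.KZ.IntegralRep n) => Literature.NumberTheory.Transcendental.KZ.of (P s.1 s.2))))^[N] (Literature.NumberTheory.Transcendental.KZ.of t) ∈ (Literature.NumberTheory.Transcendental.KZ.relations ⊔ AddSubgroup.closure {d : Literature.NumberTheory.Transcendental.KZ.FormalRep | ∃ (N N' k : ℕ) (x y : Fin N → ℚ) (x' y' : Fin N' → ℚ) (c : ℝ) (ρ : Literature.NumberTheory.Transcendental.KZ.IntegralRep N) (ρ' : Literature.NumberTheory.Transcendental.KZ.IntegralRep (2 * k + N')), (∀ j, 0 < x j ∧ 0 < y j ∧ Int.fract (x j) ≠ 0 ∧ Int.fract (y j) ≠ 0) ∧ (∀ l, 0 < x' l ∧ 0 < y' l ∧ Int.fract (x' l) ≠ 0 ∧ Int.fract (y' l) ≠ 0) ∧ (∀ u : ℕ, 0 < u → (∀ j, Nat.Coprime u (x j).den ∧ Nat.Coprime u (y j).den) → (∀ l, Nat.Coprime u (x' l).den ∧ Nat.Coprime u (y' l).den) → ((∑ j, (Int.fract ((u : ℚ) * x j) + Int.fract ((u : ℚ) * y j) - Int.fract ((u : ℚ) *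 (x j + y j)))) - ∑ l, (Int.fract ((u : ℚ) * x' l) + Int.fract ((u : ℚ) * y' l) - Int.fract ((u : ℚ) * (x' l + y' l)))) = (k : ℚ)) ∧ IsAlgebraic ℚ c ∧ ρ.domain = {t | ∀ j, t j ∈ Set.Ioo (0:ℝ) 1} ∧ Set.EqOn ρ.integrand (fun t => ∏ j, (t j) ^ ((x j : ℝ) - 1) * (1 - t j) ^ ((y j : ℝ) - 1)) ρ.domain ∧ ρ'.domain = {z | (∑ i : Fin (2 * k), (z (Fin.castAdd N' i)) ^ 2) < 1 ∧ ∀ l : Fin N', z (Fin.natAdd (2 * k) l) ∈ Set.Ioo (0:ℝ) 1} ∧ Set.EqOn ρ'.integrand (fun z => c * (k.factorial : ℝ) * ∏ l, (z (Fin.natAdd (2 * k) l)) ^ ((x' l : ℝ) - 1) * (1 - z (Fin.natAdd (2 * k) l)) ^ ((y' l : ℝ) - 1)) ρ'.domain ∧ ρ.value = ρ'.value ∧ d = Literature.NumberTheory.Transcendental.KZ.of ρ - Literature.NumberTheory.Transcendental.KZ.of ρ'}) := by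
  sorry

/-- **Transport (was stub 2; PROVED): the pinned disc operator preserves the KZ relations.** The
pinned form of the left-ideal property: `lift P c = [π]*c − ([π]*c − lift P c)`, both terms relations
(`KZ.mul_mem_relations_left_holds`; `BetaCancellationLine.piRep_mul_sub_lift_mem_relations`, landed).
[cite: KontsevichZagier2001, §1.2] -/
theorem stub_pinnedPreservesRelations : ∀ (P : ∀ n : ℕ, Literature.NumberTheory.Transcendental.KZ.IntegralRep n → Literature.NumberTheory.Transcendental.KZ.IntegralRep (n + 2)), (∀ (n : ℕ) (r : Literature.NumberTheory.Transcendental.KZ.IntegralRep n), (P n r).domain = {z : Fin (n + 2) → ℝ | z 0 ^ 2 + z 1 ^ 2 ≤ 1 ∧ (fun i : Fin n => z i.succ.succ) ∈ r.domain} ∧ (P n r).integrand = fun z => r.integrand (fun i : Fin n => z i.succ.succ)) → ∀ c ∈ Literature.NumberTheory.Transcendental.KZ.relations, FreeAbelianGroup.lift (fun s : (Σ n, Literature.NumberTheory.Transcendental.KZ.IntegralRep n) => Literature.NumberTheory.Transcendental.KZ.of (P s.1 s.2)) c ∈ Literature.NumberTheory.Transcendental.KZ.relations := by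
  intro P hP c hc
  have h1 : of piRep * c ∈ relations := mul_mem_relations_left_holds c (of piRep) hc
  have h2 := Summit.KontsevichZagierPeriods.KontsevichZagierPeriods.BetaCancellationLine.piRep_mul_sub_lift_mem_relations P hP c
  have : FreeAbelianGroup.lift (fun s : (Σ n, IntegralRep n) => of (P s.1 s.2)) c =
      of piRep * c - (of piRep * c - FreeAbelianGroup.lift (fun s : (Σ n, IntegralRep n) => of (P s.1 s.2)) c) := by
    rw [sub_sub_cancel]
  rw [this]
  exact relations.sub_mem h1 h2

/-- Iterates of an additive map are additive (subtraction form). [folklore] -/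
theorem iterate_map_sub (f : FormalRep →+ FormalRep) (N : ℕ) (x y : FormalRep) :
    (⇑f)^[N] (x - y) = (⇑f)^[N] x - (⇑f)^[N] y := by
  induction N with
  | zero => rfl
  | succ N ih => simp only [Function.iterate_succ_apply', ih, map_sub]

/-- Iterates of a relations-preserving operator preserve relations. [folklore] -/
theorem iterate_mem_relations {f : FormalRep →+ FormalRep} (hf : ∀ c ∈ relations, f c ∈ relations) :
    ∀ (N : ℕ) (c : FormalRep), c ∈ relations → (⇑f)^[N] c ∈ relations
  | 0, _, h => h
  | N + 1, c, h => by
    rw [Function.iterate_succ_apply']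
    exact hf _ (iterate_mem_relations hf N c h)

/-- **Composition** (kernel-checked): merge to one tame cube (landed `stub_cubeMerge`), read off its
value by soundness, apply the core, transport the difference along the disc iterates. [folklore] -/
theorem CubicalPiLocalKernelModGamma_of
    (h1 : ∀ (P : ∀ n : ℕ, Literature.NumberTheory.Transcendental.KZ.IntegralRep n → Literature.NumberTheory.Transcendental.KZ.IntegralRep (n + 2)), (∀ (n : ℕ) (r : Literature.NumberTheory.Transcendental.KZ.IntegralRep n), (P n r).domain = {z : Fin (n + 2) → ℝ | z 0 ^ 2 + z 1 ^ 2 ≤ 1 ∧ (fun i : Fin n => z i.succ.succ) ∈ r.domain} ∧ (P n r).integrand = fun z => r.integrand (fun i : Fin n => z i.succ.succ)) → ∀ (n : ℕ) (t : Literature.NumberTheory.Transcendental.KZ.IntegralRep n), t.domain = {x | ∀ i, 0 ≤ x i ∧ x i ≤ 1} → AnalyticOnNhd ℝ t.integrand {x | ∀ i, 0 ≤ x i ∧ x i ≤ 1} → t.value = 0 → ∃ N : ℕ, (⇑(FreeAbelianGroup.lift (fun s : (Σ n, Literature.NumberTheory.Transcendental.KZ.IntegralRep n) => Literature.NumberTheory.Transcendental.KZ.of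 (P s.1 s.2))))^[N] (Literature.NumberTheory.Transcendental.KZ.of t) ∈ (Literature.NumberTheory.Transcendental.KZ.relations ⊔ AddSubgroup.closure {d : Literature.NumberTheory.Transcendental.KZ.FormalRep | ∃ (N N' k : ℕ) (x y : Fin N → ℚ) (x' y' : Fin N' → ℚ) (c : ℝ) (ρ : Literature.NumberTheory.Transcendental.KZ.IntegralRep N) (ρ' : Literature.NumberTheory.Transcendental.KZ.IntegralRep (2 * k + N')), (∀ j, 0 < x j ∧ 0 < y j ∧ Int.fract (x j) ≠ 0 ∧ Int.fract (y j) ≠ 0) ∧ (∀ l, 0 < x' l ∧ 0 < y' l ∧ Int.fract (x' l) ≠ 0 ∧ Int.fract (y' l) ≠ 0) ∧ (∀ u : ℕ, 0 < u → (∀ j, Nat.Coprime u (x j).den ∧ Nat.Coprime u (y j).den) → (∀ l, Nat.Coprime u (x' l).den ∧ Nat.Coprime u (y' l).den) → ((∑ j, (Int.fract ((u : ℚ) * x j) + Int.fract ((u : ℚ) * y j) - Int.fract ((u : ℚ) * (x j + y j)))) - ∑ l, (Int.fract ((u : ℚ) * x' l) + Int.fract ((u : ℚ) * y' l) - Int.fract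 ((u : ℚ) * (x' l + y' l)))) = (k : ℚ)) ∧ IsAlgebraic ℚ c ∧ ρ.domain = {t | ∀ j, t j ∈ Set.Ioo (0:ℝ) 1} ∧ Set.EqOn ρ.integrand (fun t => ∏ j, (t j) ^ ((x j : ℝ) - 1) * (1 - t j) ^ ((y j : ℝ) - 1)) ρ.domain ∧ ρ'.domain = {z | (∑ i : Fin (2 * k), (z (Fin.castAdd N' i)) ^ 2) < 1 ∧ ∀ l : Fin N', z (Fin.natAdd (2 * k) l) ∈ Set.Ioo (0:ℝ) 1} ∧ Set.EqOn ρ'.integrand (fun z => c * (k.factorial : ℝ) * ∏ l, (z (Fin.natAdd (2 * k) l)) ^ ((x' l : ℝ) - 1) * (1 - z (Fin.natAdd (2 * k) l)) ^ ((y' l : ℝ) - 1)) ρ'.domain ∧ ρ.value = ρ'.value ∧ d = Literature.NumberTheory.Transcendental.KZ.of ρ - Literature.NumberTheory.Transcendental.KZ.of ρ'}))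
    (h2 : ∀ (P : ∀ n : ℕ, Literature.NumberTheory.Transcendental.KZ.IntegralRep n → Literature.NumberTheory.Transcendental.KZ.IntegralRep (n + 2)), (∀ (n : ℕ) (r : Literature.NumberTheory.Transcendental.KZ.IntegralRep n), (P n r).domain = {z : Fin (n + 2) → ℝ | z 0 ^ 2 + z 1 ^ 2 ≤ 1 ∧ (fun i : Fin n => z i.succ.succ) ∈ r.domain} ∧ (P n r).integrand = fun z => r.integrand (fun i : Fin n => z i.succ.succ)) → ∀ c ∈ Literature.NumberTheory.Transcendental.KZ.relations, FreeAbelianGroup.lift (fun s : (Σ n, Literature.NumberTheory.Transcendental.KZ.IntegralRep n) => Literature.NumberTheory.Transcendental.KZ.of (P s.1 s.2)) c ∈ Literature.NumberTheory.Transcendental.KZ.relations) :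
    CubicalPiLocalKernelModGamma := by
  intro P hP a ha ha0
  -- merge: `a ≡ [t]`, `t` a tame cube class
  obtain ⟨n, t, htd, hta, hat⟩ := stub_cubeMerge a ha
  -- soundness: `t.value = eval a = 0`
  have ht0 : t.value = 0 := by
    have h := relations_le_ker_eval_holds hat
    rw [AddMonoidHom.mem_ker, map_sub, ha0, zero_sub, neg_eq_zero, eval_of] at h
    exact h
  -- the core on one cube
  obtain ⟨N, hN⟩ := h1 P hP n t htd hta ht0
  refine ⟨N, ?_⟩
  -- transport `a − [t] ∈ relations` along the iterates
  set f : FormalRep →+ FormalRep :=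
    FreeAbelianGroup.lift (fun s : (Σ n, IntegralRep n) => of (P s.1 s.2)) with hf
  have hdiff : (⇑f)^[N] (a - of t) ∈ relations := iterate_mem_relations (h2 P hP) N _ hat
  have hsplit : (⇑f)^[N] a = (⇑f)^[N] (a - of t) + (⇑f)^[N] (of t) := by
    rw [iterate_map_sub, sub_add_cancel]
  rw [hsplit]
  exact AddSubgroup.add_mem _ (AddSubgroup.mem_sup_left hdiff) hN

/-- The leaf from the registered stubs. -/
theorem cubicalPiLocalKernelModGamma_of_stubs : CubicalPiLocalKernelModGamma :=
  CubicalPiLocalKernelModGamma_of stub_oneCubePiTorsionModGamma stub_pinnedPreservesRelations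

end Summit.KontsevichZagierPeriods.KontsevichZagierPeriods.Cruxes.CompleteModGammaSector.BirthCubicalPiLocalKernelModGamma
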